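import Literature.Analysis.FluidPDE.TaoH1APriori
import Literature.Analysis.FluidPDE.NSH1BoundedSmoothing
import HarnessLib

/-!
# Quantitative regularity (Tao 2011, Lemma 5.5): discharge of
# `Literature.Analysis.FluidPDE.tao2011_quantitative_regularity`

This file proves `tao2011_quantitative_regularity_holds : tao2011_quantitative_regularity`
(`TaoH1APriori.lean`; T. Tao, *Localisation and compactness properties of the Navier–Stokes
global regularity problem*, Anal. PDE 6 (2013) = arXiv:1108.1165, Lemma 5.5 = arXiv Lemma 32,
pp. 18–19, homogeneous case, viscosity `ν > 0`, classical solutions in the smooth `H¹` class):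
for every order `k`, viscosity `ν > 0`, times `0 < τ < T` and bounds `E, S, I` there is a constant
`C = C(k, ν, τ, T, E, S, I)` such that every classical solution of the unforced system on
`[0, T] × ℝ³` with `∫|u(t)|² ≤ E`, `∫|∇u(t)|² ≤ S` (`t ∈ [0, T]`) and `∫₀ᵀ∫‖D²u‖² ≤ I` obeys
`∫ ‖Dᵏu(t)‖² ≤ C` for all `t ∈ [τ, T]`.

## The proof

Tao's printed proof runs through the mild (Duhamel) formulation (`PB(u,u) ∈ L⁴_t L²_x`,
smoothing of the free evolution, `X^s` for `s < 3/2`, Sobolev, `X²`, iterate). The tree proves the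
same smoothing for classical solutions by the physical-space vorticity energy method
(`NSVorticitySlice` → `NSEnstrophyPersistence` → `NSH1BoundedSmoothing`: the `H^m` energy
estimate of Majda–Bertozzi 2002, §3.2, run on the differentiated vorticity equation with cutoffs,
Grönwall, the weighted div–curl inequality, exhaustion `R → ∞`, and a restart of the persistence
step at almost-every-time `H^{n+1}` data), but packages the results *qualitatively*
(`(h : IsClassicalNSSolutionOn …) → ∃ M, …`), although every constant in those proofs is an explicit
expression in `ν`, `n`, `T`, the lower-order bounds and the universal constants of the core
inequalities (`slice_energy_inequality_core`, which is already stated uniformly in the field).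
The present file re-threads that chain with the constant chosen **before** the solution:

1. `slice_energy_inequality_quant` — the slice inequality with `C₀ = C₀(ν, n, S)` uniform in the
   solution, the slab `[0, T]`, the radius `R ≥ 1` and the time;
2. `uniform_enstrophy_bounds_quant` — time integration and Grönwall with
   `M = M(ν, n, T_max, S, I, X₀)`, for all slabs `[0, T]`, `T ≤ T_max` (the constants are monotone
   in `T`, which is what the restart at a variable good time needs);
3. `sobolev_step_quant` — the step `Xⁿ → X^{n+1}` on `[0, T]` with a bound depending on the datum
   only through `D₀ ≥ ∫ |∇^{n+1}u(0)|²`;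
4. `IsClassicalNSSolutionOn.exists_integral_levelSq_le` — a *quantitative* good time: if
   `∫ₐᵀ∫ χ_R²|∇ᵏu|² ≤ I` for all `R ≥ 1` then some `t₀ ∈ (a, b)` has `∫ |∇ᵏu(t₀)|² ≤ I / (b − a)`
   (first moment method, `MeasureTheory.exists_le_setLAverage`);
5. `sobolevLevels_succ_quant`, `sobolevLevels_quant` — the restarted induction on the level with
   uniform constants (restart at `b/2`, translate by `t₀`, apply 3 on `[0, T − t₀] ⊆ [0, T]`);
6. `tao2011_quantitative_regularity_holds` — conversion of the hypotheses `E, S, I` to the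
   coordinate tensors (`levelSq_zero_eq_norm_sq`, `levelSq_one_eq_frobeniusNormSq`,
   `ofReal_integral_cutoff_sq_mul_levelSq_le`) and of the conclusion back to `‖Dᵏu‖²`
   (`lintegral_sq_norm_iteratedFDeriv_le`).

No new definitions; all intermediate statements are folklore (the classical parabolic smoothing
in the Sobolev scale with its standard dependence of constants).

## References

* T. Tao, arXiv:1108.1165 = Anal. PDE 6 (2013) (`Tao2011`): Lemma 5.5 (held arXiv copy:
  Lemma 32, p. 18 line 88 – p. 19 line 25), Thm. 5.4 (ii) (arXiv Thm. 31).
* A. J. Majda, A. L. Bertozzi, *Vorticity and Incompressible Flow*, CUP (2002)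
  (`MajdaBertozzi2002`), §3.2, Prop. 3.7, (3.58) (the `H^m` energy method). [folklore]
* J. C. Robinson, J. L. Rodrigo, W. Sadowski, CUP 2016 (`RobinsonRodrigoSadowski2016`), Thm. 7.1
  with (7.2)–(7.3) and the proof of Thm. 7.3 (the same statement for strong solutions).
-/

noncomputable section

open MeasureTheory Set Function Filter Topology
open scoped ENNReal NNReal ContDiff BigOperators

namespace Literature.Analysis.FluidPDE

/-! ## The slice inequality and Grönwall, uniformly in the solution -/

/-- **The slice energy inequality, uniformly in the solution.** Given `ν > 0`, `n ≥ 1` and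
nonnegative constants `S m`, there is `C₀` such that for every unforced classical solution `u` on a
slab `[0, T] × ℝ³`, all `R ≥ 1` and all `t ∈ [0, T]` at which `∫ |∇ᵐu(t)|² ≤ S m` for `m ≤ n`:
`∑ 2 ∫ χ_R⁴ ∂ₜ(∂^βΩ_{ki}) ∂^βΩ_{ki} ≤ −ν ∫ χ_R⁴ |∇^{n+1}Ω|² + C₀ (1 + ∫ χ_R⁴ |∇ⁿΩ|² + ∫ χ_R² |∇^{n+1}u|²)`
(the tree's `IsClassicalNSSolutionOn.slice_energy_inequality` with the constant of
`slice_energy_inequality_core` chosen before the solution). [folklore] -/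
theorem slice_energy_inequality_quant {ν : ℝ} (hν : 0 < ν) {n : ℕ} (hn : 1 ≤ n) (S : ℕ → ℝ)
    (hS : ∀ m, 0 ≤ S m) :
    ∃ C₀ : ℝ, 0 ≤ C₀ ∧ ∀ ⦃T : ℝ⦄ ⦃u : ℝ → EuclideanSpace ℝ (Fin 3) → EuclideanSpace ℝ (Fin 3)⦄
      ⦃p : ℝ → EuclideanSpace ℝ (Fin 3) → ℝ⦄,
      IsClassicalNSSolutionOn (Icc 0 T) ν 0 u p → 0 < T → ∀ R : ℝ, 1 ≤ R → ∀ t ∈ Icc 0 T,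
      (∀ m ≤ n, Integrable (levelSq m (u t))) → (∀ m ≤ n, ∫ x, levelSq m (u t) x ≤ S m) →
      ∑ c', 2 * ∫ x, cutoff R x ^ 4 *
          (FluidPDE.timeDerivWithin (Icc 0 T) (fun s y => vortFam n (u s) c' y) t x *
            vortFam n (u t) c' x) ≤
        -ν * (∫ x, cutoff R x ^ 4 * vortSq (n + 1) (u t) x) +
          C₀ * (1 + (∫ x, cutoff R x ^ 4 * vortSq n (u t) x) +
            ∫ x, cutoff R x ^ 2 * levelSq (n + 1) (u t) x) := by
  obtain ⟨c, hc0, hc⟩ := exists_norm_fderiv_cutoff_le (E := EuclideanSpace ℝ (Fin 3))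
  have hCF : (0 : ℝ) ≤ 2 * 3 * 2 ^ (n + 1) := by positivity
  obtain ⟨C₀, hC₀0, hC₀⟩ := slice_energy_inequality_core hν hc0 hCF hn S hS
  refine ⟨C₀, hC₀0, fun T u p h hT R hR t ht hint hSv => ?_⟩
  have hR0 : 0 < R := by linarith
  have hU := uniqueDiffOn_Icc hT
  have hcl := Icc_subset_closure_interior hT
  have hv : ContDiff ℝ ∞ (u t) := h.contDiff_velocity ht
  have hdiv : ∀ x, ∑ i, pderiv i (fun y => u t y i) x = 0 := fun x =>
    h.sum_pderiv_comp_eq_zero ht x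
  -- the cutoffs
  have hgrad : ∀ {R'}, 1 ≤ R' → ∀ x, ‖fderiv ℝ (cutoff R') x‖ ≤ c := fun {R'} hR' x =>
    (hc R' (by linarith) x).trans (div_le_self hc0 hR')
  -- the time derivatives
  have hWc : ∀ c', Continuous fun x =>
      FluidPDE.timeDerivWithin (Icc 0 T) (fun s y => vortFam n (u s) c' y) t x := fun c' =>
    (((h.isSmoothSpaceTimeOn_vortFam hT n c').timeDerivWithin hU).contDiff_slice ht).continuous
  have hforce : ∀ c' x,
      |FluidPDE.timeDerivWithin (Icc 0 T) (fun s y => vortFam n (u s) c' y) t x -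
        ν * ∑ j, pderiv j (pderiv j (vortFam n (u t) c')) x +
        ∑ j, u t x j * pderiv j (vortFam n (u t) c') x| ≤
      2 * 3 * 2 ^ (n + 1) * ∑ a ∈ Finset.Icc 1 (n + 1),
        Real.sqrt (levelSq a (u t) x) * Real.sqrt (levelSq (n + 2 - a) (u t) x) := by
    intro c' x
    have := h.abs_vorticity_forcing_le hU hcl ht x c'.1 c'.2.1 c'.2.2
    rw [Fintype.card_fin] at this
    push_cast at this
    exact this
  exact hC₀ (u t) (cutoff R) (cutoff (2 * R)) _ hv hdiv (contDiff_cutoff R)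
    (hasCompactSupport_cutoff hR0) (cutoff_nonneg R) (cutoff_le_one R) (hgrad hR)
    (contDiff_cutoff (2 * R)) (hasCompactSupport_cutoff (by linarith)) (cutoff_nonneg (2 * R))
    (cutoff_le_one (2 * R)) (hgrad (by linarith)) (fun x hx => cutoff_two_mul_eq_one_of_ne hR0 hx)
    hWc hforce hint hSv

/-- **Uniform localised bounds (Grönwall), uniformly in the solution.** Given `ν > 0`, `n ≥ 1`,
a maximal time `T_max > 0`, nonnegative constants `S m`, `I ≥ 0` and `X₀ ≥ 0`, there is `M ≥ 0`
such that for every unforced classical solution `u` on `[0, T] × ℝ³` with `0 < T ≤ T_max`,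
`∫ |∇ᵐu(t)|² ≤ S m` (`m ≤ n`, `t ∈ [0, T]`), `∫₀ᵀ ∫ χ_R² |∇^{n+1}u|² ≤ I` and
`∫ χ_R⁴ |∇ⁿΩ(0)|² ≤ X₀` for all `R ≥ 1`: `∫ χ_R⁴ |∇ⁿΩ(t)|² ≤ M` (`t ∈ [0, T]`) and
`∫₀ᵀ ∫ χ_R⁴ |∇^{n+1}Ω|² ≤ M` for all `R ≥ 1` — explicitly
`M = max (A e^{C₀T_max}) ((A + C₀ T_max A e^{C₀T_max}) / ν)`, `A = X₀ + C₀ T_max + C₀ I` (the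
tree's `uniform_enstrophy_bounds`, constant first). [folklore] -/
theorem uniform_enstrophy_bounds_quant {ν Tmax : ℝ} (hν : 0 < ν) (hTmax : 0 < Tmax) {n : ℕ}
    (hn : 1 ≤ n) (S : ℕ → ℝ) (hS : ∀ m, 0 ≤ S m) {I X₀ : ℝ} (hI0 : 0 ≤ I) (hX₀0 : 0 ≤ X₀) :
    ∃ M : ℝ, 0 ≤ M ∧ ∀ ⦃T : ℝ⦄ ⦃u : ℝ → EuclideanSpace ℝ (Fin 3) → EuclideanSpace ℝ (Fin 3)⦄
      ⦃p : ℝ → EuclideanSpace ℝ (Fin 3) → ℝ⦄,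
      IsClassicalNSSolutionOn (Icc 0 T) ν 0 u p → 0 < T → T ≤ Tmax →
      (∀ m ≤ n, ∀ t ∈ Icc 0 T, Integrable (levelSq m (u t)) ∧ ∫ x, levelSq m (u t) x ≤ S m) →
      (∀ R : ℝ, 1 ≤ R →
        ∫ τ in Ioo 0 T, ∫ x, cutoff R x ^ 2 * levelSq (n + 1) (u τ) x ≤ I) →
      (∀ R : ℝ, 1 ≤ R → ∫ x, cutoff R x ^ 4 * vortSq n (u 0) x ≤ X₀) →
      ∀ R : ℝ, 1 ≤ R →
        (∀ t ∈ Icc 0 T, ∫ x, cutoff R x ^ 4 * vortSq n (u t) x ≤ M) ∧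
          ∫ τ in Ioo 0 T, ∫ x, cutoff R x ^ 4 * vortSq (n + 1) (u τ) x ≤ M := by
  obtain ⟨C₀, hC₀0, hC₀⟩ := slice_energy_inequality_quant hν hn S hS
  set A : ℝ := X₀ + C₀ * Tmax + C₀ * I with hA
  have hA0 : 0 ≤ A := by positivity
  set M₁ : ℝ := A * Real.exp (C₀ * Tmax) with hM₁
  have hM₁0 : 0 ≤ M₁ := by positivity
  refine ⟨max M₁ ((A + C₀ * (Tmax * M₁)) / ν), le_max_of_le_left hM₁0,
    fun T u p h hT hTle hPS hPI hX₀ R hR => ?_⟩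
  have hR0 : 0 < R := by linarith
  have h0T : (0 : ℝ) ∈ Icc 0 T := ⟨le_rfl, hT.le⟩
  -- the four functions of time (opaque, with defining equations)
  obtain ⟨X, hX⟩ : ∃ X : ℝ → ℝ, X = fun t => ∫ x, cutoff R x ^ 4 * vortSq n (u t) x := ⟨_, rfl⟩
  obtain ⟨D, hD⟩ : ∃ D : ℝ → ℝ, D = fun t => ∫ x, cutoff R x ^ 4 * vortSq (n + 1) (u t) x :=
    ⟨_, rfl⟩
  obtain ⟨Y, hY⟩ : ∃ Y : ℝ → ℝ, Y = fun t => ∫ x, cutoff R x ^ 2 * levelSq (n + 1) (u t) x :=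
    ⟨_, rfl⟩
  obtain ⟨Φ, hΦ⟩ : ∃ Φ : ℝ → ℝ, Φ = fun t => ∑ c', 2 * ∫ x, cutoff R x ^ 4 *
      (FluidPDE.timeDerivWithin (Icc 0 T) (fun s y => vortFam n (u s) c' y) t x *
        vortFam n (u t) c' x) := ⟨_, rfl⟩
  have cX : ContinuousOn X (Icc 0 T) := by
    rw [hX]; exact h.continuousOn_integral_cutoff_pow_mul_vortSq hT hR0 4 n (by norm_num)
  have cD : ContinuousOn D (Icc 0 T) := by
    rw [hD]; exact h.continuousOn_integral_cutoff_pow_mul_vortSq hT hR0 4 (n + 1) (by norm_num)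
  have cY : ContinuousOn Y (Icc 0 T) := by
    rw [hY]; exact h.continuousOn_integral_cutoff_pow_mul_levelSq hT hR0 2 (n + 1) (by norm_num)
  have cΦ : ContinuousOn Φ (Icc 0 T) := by
    rw [hΦ]
    exact continuousOn_finsetSum _ fun c' _ =>
      (h.continuousOn_integral_cutoff_pow_mul_timeDerivWithin_mul hT hR0 n c').const_smul (2 : ℝ)
        |>.congr fun t _ => by simp [smul_eq_mul]
  have hX0' : ∀ t, 0 ≤ X t := fun t => by
    rw [hX]; exact integral_nonneg fun x =>
      mul_nonneg (pow_nonneg (cutoff_nonneg _ _) 4) (vortSq_nonneg _ _ _)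
  have hD0' : ∀ t, 0 ≤ D t := fun t => by
    rw [hD]; exact integral_nonneg fun x =>
      mul_nonneg (pow_nonneg (cutoff_nonneg _ _) 4) (vortSq_nonneg _ _ _)
  have hY0' : ∀ t, 0 ≤ Y t := fun t => by
    rw [hY]; exact integral_nonneg fun x => mul_nonneg (sq_nonneg _) (levelSq_nonneg _ _ _)
  -- the slice inequality and the time identity
  have hSEI : ∀ τ ∈ Icc 0 T, Φ τ ≤ -ν * D τ + C₀ * (1 + X τ + Y τ) := fun τ hτ => by
    rw [hΦ, hD, hX, hY]
    exact hC₀ h hT R hR τ hτ (fun m hm => (hPS m hm τ hτ).1) (fun m hm => (hPS m hm τ hτ).2)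
  have hFTC : ∀ t ∈ Icc 0 T, X t - X 0 = ∫ τ in Ioo 0 t, Φ τ := fun t ht => by
    rw [hX, hΦ]; exact h.integral_cutoff_vortSq_sub_eq hT hR0 n ht
  -- integrate the slice inequality
  have hY_le : ∀ t ∈ Icc 0 T, ∫ τ in Ioo 0 t, Y τ ≤ I := fun t ht => by
    refine le_trans (setIntegral_mono_set (integrableOn_Ioo_of_continuousOn cY ⟨hT.le, le_rfl⟩)
      (ae_of_all _ fun τ => hY0' τ) (ae_of_all _ (Ioo_subset_Ioo le_rfl ht.2))) ?_
    rw [hY]; exact hPI R hR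
  have hmain : ∀ t ∈ Icc 0 T, X t + ν * ∫ τ in Ioo 0 t, D τ ≤ A + C₀ * ∫ τ in Ioo 0 t, X τ := by
    intro t ht
    have iΦ := integrableOn_Ioo_of_continuousOn cΦ ht
    have iX := integrableOn_Ioo_of_continuousOn cX ht
    have iD := integrableOn_Ioo_of_continuousOn cD ht
    have iY := integrableOn_Ioo_of_continuousOn cY ht
    have i1 : IntegrableOn (fun _ => (1 : ℝ)) (Ioo 0 t) :=
      integrableOn_const (by rw [Real.volume_Ioo]; exact ENNReal.ofReal_ne_top)
    have i1X : IntegrableOn (fun τ => 1 + X τ) (Ioo 0 t) := i1.add iX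
    have iXY : IntegrableOn (fun τ => 1 + X τ + Y τ) (Ioo 0 t) := i1X.add iY
    have iC : IntegrableOn (fun τ => C₀ * (1 + X τ + Y τ)) (Ioo 0 t) := iXY.const_mul _
    have iνD : IntegrableOn (fun τ => -ν * D τ) (Ioo 0 t) := iD.const_mul _
    have iR : IntegrableOn (fun τ => -ν * D τ + C₀ * (1 + X τ + Y τ)) (Ioo 0 t) := iνD.add iC
    have hmono : ∫ τ in Ioo 0 t, Φ τ ≤ ∫ τ in Ioo 0 t, (-ν * D τ + C₀ * (1 + X τ + Y τ)) :=
      setIntegral_mono_on iΦ iR measurableSet_Ioo fun τ hτ =>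
        hSEI τ ⟨hτ.1.le, hτ.2.le.trans ht.2⟩
    have e : ∫ τ in Ioo 0 t, (-ν * D τ + C₀ * (1 + X τ + Y τ)) =
        -ν * (∫ τ in Ioo 0 t, D τ) +
          C₀ * (t + (∫ τ in Ioo 0 t, X τ) + ∫ τ in Ioo 0 t, Y τ) := by
      rw [integral_add iνD iC, integral_const_mul, integral_const_mul, integral_add i1X iY,
        integral_add i1 iX, setIntegral_const, Real.volume_real_Ioo, sub_zero, max_eq_left ht.1,
        smul_eq_mul, mul_one]
    have h1 := hFTC t ht
    have h2 := hY_le t ht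
    have h3 : X 0 ≤ X₀ := by rw [hX]; exact hX₀ R hR
    have h4 : C₀ * t ≤ C₀ * Tmax := mul_le_mul_of_nonneg_left (ht.2.trans hTle) hC₀0
    rw [hA]
    nlinarith [mul_le_mul_of_nonneg_left h2 hC₀0]
  -- Grönwall
  have hG : ∀ t ∈ Icc 0 T, X t ≤ A * Real.exp (C₀ * t) := by
    refine le_mul_exp_of_le_add_mul_integral cX hC₀0 fun t ht => ?_
    rw [intervalIntegral.integral_of_le ht.1, integral_Ioc_eq_integral_Ioo]
    have := hmain t ht
    have hD_int : 0 ≤ ∫ τ in Ioo 0 t, D τ :=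
      setIntegral_nonneg measurableSet_Ioo fun τ _ => hD0' τ
    nlinarith [mul_nonneg hν.le hD_int]
  have hXM : ∀ t ∈ Icc 0 T, X t ≤ M₁ := fun t ht =>
    (hG t ht).trans (mul_le_mul_of_nonneg_left (Real.exp_le_exp.2
      (mul_le_mul_of_nonneg_left (ht.2.trans hTle) hC₀0)) hA0)
  -- the dissipation
  have hTT : T ∈ Icc 0 T := ⟨hT.le, le_rfl⟩
  have hXint : ∫ τ in Ioo 0 T, X τ ≤ Tmax * M₁ := by
    have iX := integrableOn_Ioo_of_continuousOn cX hTT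
    have i1 : IntegrableOn (fun _ => M₁) (Ioo 0 T) :=
      integrableOn_const (by rw [Real.volume_Ioo]; exact ENNReal.ofReal_ne_top)
    calc ∫ τ in Ioo 0 T, X τ ≤ ∫ _ in Ioo 0 T, M₁ :=
          setIntegral_mono_on iX i1 measurableSet_Ioo fun τ hτ => hXM τ ⟨hτ.1.le, hτ.2.le⟩
      _ = T * M₁ := by
          rw [setIntegral_const, Real.volume_real_Ioo, sub_zero, max_eq_left hT.le, smul_eq_mul]
      _ ≤ Tmax * M₁ := mul_le_mul_of_nonneg_right hTle hM₁0
  have hDM : ∫ τ in Ioo 0 T, D τ ≤ (A + C₀ * (Tmax * M₁)) / ν := by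
    rw [le_div_iff₀ hν]
    have := hmain T hTT
    nlinarith [hX0' T, mul_le_mul_of_nonneg_left hXint hC₀0]
  refine ⟨fun t ht => ?_, ?_⟩
  · have := hXM t ht
    rw [hX] at this
    exact this.trans (le_max_left _ _)
  · rw [hD] at hDM
    exact hDM.trans (le_max_right _ _)

/-! ## The persistence step with uniform constants -/

/-- **The induction step `Xⁿ → X^{n+1}`, uniformly in the solution.** Given `ν > 0`, `n ≥ 1`,
`T_max > 0`, nonnegative constants `S m`, `I ≥ 0` and a datum bound `D₀ ≥ 0`, there is `M ≥ 0` such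
that for every unforced classical solution `u` on `[0, T] × ℝ³`, `0 < T ≤ T_max`, with
`∫ |∇^{n+1}u(0)|² ≤ D₀`, `∫ |∇ᵐu(t)|² ≤ S m` (`m ≤ n`, `t ∈ [0, T]`) and
`∫₀ᵀ ∫ χ_R² |∇^{n+1}u|² ≤ I` (`R ≥ 1`): `∫ |∇^{n+1}u(t)|² ≤ M` for `t ∈ [0, T]` and
`∫₀ᵀ ∫ χ_R² |∇^{n+2}u|² ≤ M` for `R ≥ 1` (the tree's `sobolev_step`, constant first: the initial
localised vorticity energy is `≤ 4D₀`, Grönwall by `uniform_enstrophy_bounds_quant`, the weighted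
div–curl inequality and exhaustion `R → ∞`). [folklore] -/
theorem sobolev_step_quant {ν Tmax : ℝ} (hν : 0 < ν) (hTmax : 0 < Tmax) {n : ℕ} (hn : 1 ≤ n)
    (S : ℕ → ℝ) (hS : ∀ m, 0 ≤ S m) {I D₀ : ℝ} (hI0 : 0 ≤ I) (hD₀ : 0 ≤ D₀) :
    ∃ M : ℝ, 0 ≤ M ∧ ∀ ⦃T : ℝ⦄ ⦃u : ℝ → EuclideanSpace ℝ (Fin 3) → EuclideanSpace ℝ (Fin 3)⦄
      ⦃p : ℝ → EuclideanSpace ℝ (Fin 3) → ℝ⦄,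
      IsClassicalNSSolutionOn (Icc 0 T) ν 0 u p → 0 < T → T ≤ Tmax →
      Integrable (levelSq (n + 1) (u 0)) → (∫ x, levelSq (n + 1) (u 0) x ≤ D₀) →
      (∀ m ≤ n, ∀ t ∈ Icc 0 T, Integrable (levelSq m (u t)) ∧ ∫ x, levelSq m (u t) x ≤ S m) →
      (∀ R : ℝ, 1 ≤ R →
        ∫ τ in Ioo 0 T, ∫ x, cutoff R x ^ 2 * levelSq (n + 1) (u τ) x ≤ I) →
      (∀ t ∈ Icc 0 T,
          Integrable (levelSq (n + 1) (u t)) ∧ ∫ x, levelSq (n + 1) (u t) x ≤ M) ∧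
        ∀ R : ℝ, 1 ≤ R →
          ∫ τ in Ioo 0 T, ∫ x, cutoff R x ^ 2 * levelSq (n + 2) (u τ) x ≤ M := by
  have h4D : 0 ≤ 4 * D₀ := by positivity
  obtain ⟨M, hM0, hM⟩ := uniform_enstrophy_bounds_quant hν hTmax hn S hS hI0 h4D
  obtain ⟨c, hc0, hc⟩ := exists_abs_pderiv_cutoff_le
  refine ⟨max (M + 48 * c ^ 2 * S n) (M + 48 * c ^ 2 * I),
    le_max_of_le_left (by nlinarith [hS n, sq_nonneg c]),
    fun T u p h hT hTle hdat hdatle hPS hPI => ?_⟩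
  have h0T : (0 : ℝ) ∈ Icc 0 T := ⟨le_rfl, hT.le⟩
  have hu0 : ContDiff ℝ ∞ (u 0) := h.contDiff_velocity h0T
  -- the initial localised vorticity energy
  have hvort0 : Integrable (vortSq n (u 0)) := by
    refine (hdat.const_mul 4).mono' (continuous_vortSq hu0 n).aestronglyMeasurable
      (Eventually.of_forall fun x => ?_)
    rw [Real.norm_of_nonneg (vortSq_nonneg n _ x)]
    exact vortSq_le_four_mul_levelSq_succ hu0 n x
  have hX₀ : ∀ R : ℝ, 1 ≤ R → ∫ x, cutoff R x ^ 4 * vortSq n (u 0) x ≤ 4 * D₀ := by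
    intro R hR
    have hR0 : 0 < R := by linarith
    calc ∫ x, cutoff R x ^ 4 * vortSq n (u 0) x ≤ ∫ x, vortSq n (u 0) x :=
          integral_pow_mul_le_integral (continuous_vortSq hu0 n) (vortSq_nonneg n _) hvort0
            (contDiff_cutoff (E := EuclideanSpace ℝ (Fin 3)) R)
            (hasCompactSupport_cutoff (E := EuclideanSpace ℝ (Fin 3)) hR0)
            (cutoff_nonneg R) (cutoff_le_one R) (by norm_num)
      _ ≤ ∫ x, 4 * levelSq (n + 1) (u 0) x :=
          integral_mono hvort0 (hdat.const_mul 4) fun x => vortSq_le_four_mul_levelSq_succ hu0 n x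
      _ = 4 * ∫ x, levelSq (n + 1) (u 0) x := integral_const_mul _ _
      _ ≤ 4 * D₀ := by linarith
  have hM' := hM h hT hTle hPS hPI hX₀
  refine ⟨fun t ht => ?_, fun R hR => ?_⟩
  · obtain ⟨hi, hle⟩ := h.integrable_levelSq_succ_of_uniform hc ht hM0
      (fun R hR => (hM' R hR).1 t ht) (hPS n le_rfl t ht).1 (hPS n le_rfl t ht).2
    exact ⟨hi, hle.trans (le_max_left _ _)⟩
  · exact (h.integral_Ioo_cutoff_levelSq_le_of_uniform hT hc (fun R' hR' => (hM' R' hR').2)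
      hPI hR).trans (le_max_right _ _)

/-! ## Quantitative good times and the restarted induction -/

section Solution

variable {T ν : ℝ} {u : ℝ → EuclideanSpace ℝ (Fin 3) → EuclideanSpace ℝ (Fin 3)}
  {p : ℝ → EuclideanSpace ℝ (Fin 3) → ℝ}

/-- Translation of set integrals over `Ioo` (Lebesgue measure is translation invariant); a local
copy, in the argument order used below, of the tree's `setIntegral_Ioo_comp_add_right`
(`LerayHopfRestart`, not imported here). [folklore] -/
private theorem setIntegral_Ioo_translate' (F : ℝ → ℝ) (a c d : ℝ) :
    ∫ τ in Ioo c d, F (τ + a) = ∫ τ in Ioo (c + a) (d + a), F τ := by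
  have h := (measurePreserving_add_right (volume : Measure ℝ) a).setIntegral_preimage_emb
    (MeasurableEquiv.addRight a).measurableEmbedding F (Ioo (c + a) (d + a))
  simp only [preimage_add_const_Ioo, add_sub_cancel_right] at h
  exact h

/-- Restriction of the localised `L²_t` bound to a later starting time: if
`∫ₐᵀ ∫ χ_R² |∇ᵏu|² ≤ I` and `0 ≤ a ≤ a'`, then `∫_{a'}ᵀ ∫ χ_R² |∇ᵏu|² ≤ I` (nonnegative integrand,
continuous in time on `[0, T]`). [folklore] -/
theorem IsClassicalNSSolutionOn.integral_Ioo_cutoff_levelSq_mono_left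
    (h : IsClassicalNSSolutionOn (Icc 0 T) ν 0 u p) (hT : 0 < T) (k : ℕ) {a a' : ℝ} (ha : 0 ≤ a)
    (haa' : a ≤ a') {R : ℝ} (hR : 1 ≤ R) :
    ∫ τ in Ioo a' T, ∫ x, cutoff R x ^ 2 * levelSq k (u τ) x ≤
      ∫ τ in Ioo a T, ∫ x, cutoff R x ^ 2 * levelSq k (u τ) x := by
  have hR0 : 0 < R := by linarith
  have cY := h.continuousOn_integral_cutoff_pow_mul_levelSq hT hR0 2 k two_ne_zero
  have iY : IntegrableOn (fun τ => ∫ x, cutoff R x ^ 2 * levelSq k (u τ) x) (Ioo a T) :=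
    ((cY.mono (Icc_subset_Icc ha le_rfl)).integrableOn_compact isCompact_Icc).mono_set
      Ioo_subset_Icc_self
  exact setIntegral_mono_set iY (ae_of_all _ fun τ => integral_nonneg fun x =>
    mul_nonneg (sq_nonneg _) (levelSq_nonneg _ _ _)) (ae_of_all _ (Ioo_subset_Ioo haa' le_rfl))

/-- **Quantitative good times (first moment method).** If `∫ₐᵀ ∫ χ_R² |∇ᵏu|² ≤ I` for all `R ≥ 1`
(`0 ≤ a < b ≤ T`), then some `t₀ ∈ (a, b)` has `|∇ᵏu(t₀)|²` integrable with
`∫ |∇ᵏu(t₀)|² ≤ I / (b − a)`: by exhaustion `∫ₐᵇ ∫ |∇ᵏu|² ≤ I`, and a measurable function does not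
exceed its mean everywhere (`MeasureTheory.exists_le_setLAverage`). [folklore] -/
theorem IsClassicalNSSolutionOn.exists_integral_levelSq_le
    (h : IsClassicalNSSolutionOn (Icc 0 T) ν 0 u p) {a b : ℝ} (ha : 0 ≤ a) (hab : a < b)
    (hbT : b ≤ T) (k : ℕ) {I : ℝ}
    (hI : ∀ R : ℝ, 1 ≤ R → ∫ τ in Ioo a T, ∫ x, cutoff R x ^ 2 * levelSq k (u τ) x ≤ I) :
    ∃ t₀ ∈ Ioo a b, Integrable (levelSq k (u t₀)) ∧ ∫ x, levelSq k (u t₀) x ≤ I / (b - a) := by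
  have haT : a < T := hab.trans_le hbT
  have hT : 0 < T := ha.trans_lt haT
  have hT' : 0 < T - a := by linarith
  have hba : 0 < b - a := by linarith
  have h' := h.translate_Icc_zero ha haT
  -- `I ≥ 0`
  have hI0 : 0 ≤ I := (setIntegral_nonneg measurableSet_Ioo fun τ _ =>
    integral_nonneg fun x => mul_nonneg (sq_nonneg _) (levelSq_nonneg _ _ _)).trans (hI 1 le_rfl)
  -- the bound in the translated frame
  have hI' : ∀ R : ℝ, 1 ≤ R →
      ∫ τ in Ioo 0 (T - a), ∫ x, cutoff R x ^ 2 * levelSq k (u (τ + a)) x ≤ I := by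
    intro R hR
    have e := setIntegral_Ioo_translate'
      (fun τ => ∫ x, cutoff R x ^ 2 * levelSq k (u τ) x) a 0 (T - a)
    rw [zero_add, sub_add_cancel] at e
    rw [e]
    exact hI R hR
  have hfin := h'.lintegral_Ioo_lintegral_levelSq_le hT' k hI'
  have hmeas : AEMeasurable (fun t => ∫⁻ x, ENNReal.ofReal (levelSq k (u (t + a)) x))
      ((volume : Measure ℝ).restrict (Ioo 0 (T - a))) := by
    have := h'.aemeasurable_setLIntegral_levelSq hT' k MeasurableSet.univ
    simpa only [Measure.restrict_univ] using this
  have hsub : Ioo 0 (b - a) ⊆ Ioo 0 (T - a) := Ioo_subset_Ioo le_rfl (by linarith)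
  have hmeas' : AEMeasurable (fun t => ∫⁻ x, ENNReal.ofReal (levelSq k (u (t + a)) x))
      ((volume : Measure ℝ).restrict (Ioo 0 (b - a))) :=
    hmeas.mono_measure (Measure.restrict_mono hsub le_rfl)
  have hpos : (volume : Measure ℝ) (Ioo 0 (b - a)) ≠ 0 := by
    rw [Real.volume_Ioo]; exact (ENNReal.ofReal_pos.2 (by linarith)).ne'
  have htop : (volume : Measure ℝ) (Ioo 0 (b - a)) ≠ ⊤ := by
    rw [Real.volume_Ioo]; exact ENNReal.ofReal_ne_top
  obtain ⟨τ₀, hτ₀, hle⟩ := exists_le_setLAverage hpos htop hmeas'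
  -- the mean is at most `I / (b - a)`
  have hav : ⨍⁻ t in Ioo 0 (b - a), (∫⁻ x, ENNReal.ofReal (levelSq k (u (t + a)) x)) ∂volume ≤
      ENNReal.ofReal (I / (b - a)) := by
    rw [setLAverage_eq, Real.volume_Ioo, sub_zero, ENNReal.ofReal_div_of_pos hba]
    exact ENNReal.div_le_div_right ((lintegral_mono_set hsub).trans hfin) _
  refine ⟨τ₀ + a, ⟨by linarith [hτ₀.1], by linarith [hτ₀.2]⟩, ?_⟩
  have hv : ContDiff ℝ ∞ (u (τ₀ + a)) :=
    h.contDiff_velocity ⟨by linarith [hτ₀.1], by linarith [hτ₀.2, hsub hτ₀ |>.2]⟩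
  exact integrable_and_integral_le_of_lintegral_ofReal_le (continuous_levelSq hv k)
    (levelSq_nonneg k _) (div_nonneg hI0 hba.le) (hle.trans hav)

end Solution

/-- **The restarted persistence step with uniform constants.** Given `ν > 0`, `T > 0`, `n ≥ 1`,
times `0 ≤ a < b < T` and a bound `M ≥ 0`, there is `M' ≥ 0` such that for every unforced
classical solution `u` on `[0, T] × ℝ³` whose levels hold at order `n` from time `a` on with bound
`M` — `∫ |∇ᵐu(t)|² ≤ M` for `m ≤ n`, `t ∈ [a, T]`, and `∫ₐᵀ ∫ χ_R² |∇^{n+1}u|² ≤ M` for `R ≥ 1` —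
the levels hold at order `n + 1` from time `b` on with bound `M'`: pick a good time
`t₀ ∈ (a, b)` with `∫ |∇^{n+1}u(t₀)|² ≤ M / (b − a)` (`exists_integral_levelSq_le`) and apply
`sobolev_step_quant` to the translate `u(· + t₀)` on `[0, T − t₀]`, `T − t₀ ≤ T`. [folklore] -/
theorem sobolevLevels_succ_quant {ν T : ℝ} (hν : 0 < ν) (hT : 0 < T) {n : ℕ} (hn : 1 ≤ n)
    {a b : ℝ} (ha : 0 ≤ a) (hab : a < b) (hbT : b < T) {M : ℝ} (hM0 : 0 ≤ M) :
    ∃ M' : ℝ, 0 ≤ M' ∧ ∀ ⦃u : ℝ → EuclideanSpace ℝ (Fin 3) → EuclideanSpace ℝ (Fin 3)⦄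
      ⦃p : ℝ → EuclideanSpace ℝ (Fin 3) → ℝ⦄,
      IsClassicalNSSolutionOn (Icc 0 T) ν 0 u p →
      ((∀ m ≤ n, ∀ t ∈ Icc a T, Integrable (levelSq m (u t)) ∧ ∫ x, levelSq m (u t) x ≤ M) ∧
        ∀ R : ℝ, 1 ≤ R → ∫ τ in Ioo a T, ∫ x, cutoff R x ^ 2 * levelSq (n + 1) (u τ) x ≤ M) →
      ((∀ m ≤ n + 1, ∀ t ∈ Icc b T,
          Integrable (levelSq m (u t)) ∧ ∫ x, levelSq m (u t) x ≤ M') ∧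
        ∀ R : ℝ, 1 ≤ R →
          ∫ τ in Ioo b T, ∫ x, cutoff R x ^ 2 * levelSq (n + 1 + 1) (u τ) x ≤ M') := by
  have hba : 0 < b - a := by linarith
  obtain ⟨M₁, hM₁0, hM₁⟩ := sobolev_step_quant hν hT hn (fun _ => M) (fun _ => hM0) hM0
    (div_nonneg hM0 hba.le)
  refine ⟨max M M₁, le_max_of_le_left hM0, fun u p h hL => ?_⟩
  obtain ⟨hS, hI⟩ := hL
  obtain ⟨t₀, ht₀, hdat, hdatle⟩ := h.exists_integral_levelSq_le ha hab hbT.le (n + 1) hI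
  have ht₀0 : 0 ≤ t₀ := ha.trans ht₀.1.le
  have ht₀T : t₀ < T := ht₀.2.trans hbT
  have hT' : 0 < T - t₀ := by linarith
  have h' := h.translate_Icc_zero ht₀0 ht₀T
  -- hypotheses of `sobolev_step_quant` in the translated frame
  have hdat' : Integrable (levelSq (n + 1) ((fun t => u (t + t₀)) 0)) := by
    simpa only [zero_add] using hdat
  have hdatle' : ∫ x, levelSq (n + 1) ((fun t => u (t + t₀)) 0) x ≤ M / (b - a) := by
    simpa only [zero_add] using hdatle
  have hPS' : ∀ m ≤ n, ∀ t ∈ Icc 0 (T - t₀),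
      Integrable (levelSq m (u (t + t₀))) ∧ ∫ x, levelSq m (u (t + t₀)) x ≤ M :=
    fun m hm t ht => hS m hm (t + t₀) ⟨by linarith [ht.1, ht₀.1], by linarith [ht.2]⟩
  have hPI' : ∀ R : ℝ, 1 ≤ R →
      ∫ τ in Ioo 0 (T - t₀), ∫ x, cutoff R x ^ 2 * levelSq (n + 1) (u (τ + t₀)) x ≤ M := by
    intro R hR
    have e := setIntegral_Ioo_translate'
      (fun τ => ∫ x, cutoff R x ^ 2 * levelSq (n + 1) (u τ) x) t₀ 0 (T - t₀)
    rw [zero_add, sub_add_cancel] at e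
    rw [e]
    exact (h.integral_Ioo_cutoff_levelSq_mono_left hT (n + 1) ha ht₀.1.le hR).trans (hI R hR)
  obtain ⟨hS₁, hI₁⟩ := hM₁ h' hT' (by linarith) hdat' hdatle' hPS' hPI'
  refine ⟨fun m hm t ht => ?_, fun R hR => ?_⟩
  · rcases Nat.lt_or_ge m (n + 1) with hm' | hm'
    · obtain ⟨hi, hle⟩ := hS m (Nat.lt_succ_iff.1 hm') t ⟨by linarith [ht.1], ht.2⟩
      exact ⟨hi, hle.trans (le_max_left _ _)⟩
    · have : m = n + 1 := le_antisymm hm hm'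
      subst this
      have := hS₁ (t - t₀) ⟨by linarith [ht.1, ht₀.2], by linarith [ht.2]⟩
      simp only [sub_add_cancel] at this
      exact ⟨this.1, this.2.trans (le_max_right _ _)⟩
  · have e := setIntegral_Ioo_translate'
      (fun τ => ∫ x, cutoff R x ^ 2 * levelSq (n + 1 + 1) (u τ) x) t₀ 0 (T - t₀)
    rw [zero_add, sub_add_cancel] at e
    have hI₁' : ∫ τ in Ioo t₀ T, ∫ x, cutoff R x ^ 2 * levelSq (n + 1 + 1) (u τ) x ≤ M₁ := by
      rw [← e]; exact hI₁ R hR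
    exact ((h.integral_Ioo_cutoff_levelSq_mono_left hT (n + 1 + 1) ht₀0 ht₀.2.le hR).trans
      hI₁').trans (le_max_right _ _)

/-- **All levels after any positive time, with uniform constants.** Given `ν > 0`, `T > 0`, a
level-one bound `M ≥ 0`, an order `n ≥ 1` and a time `b ∈ (0, T)`, there is `M' ≥ 0` such that
every unforced classical solution `u` on `[0, T] × ℝ³` with `∫ |u(t)|², ∫ |∇u(t)|² ≤ M`
(`t ∈ [0, T]`) and `∫₀ᵀ ∫ χ_R² |∇²u|² ≤ M` (`R ≥ 1`) has `∫ |∇ᵐu(t)|² ≤ M'` for all `m ≤ n`,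
`t ∈ [b, T]`, and `∫_bᵀ ∫ χ_R² |∇^{n+1}u|² ≤ M'` for `R ≥ 1` (induction on `n`, restarting at `b/2`
with `sobolevLevels_succ_quant`). This is the quantitative form of the tree's
`IsClassicalNSSolutionOn.sobolevLevels_of_h1Bounded`. [folklore] -/
theorem sobolevLevels_quant {ν T : ℝ} (hν : 0 < ν) (hT : 0 < T) {M : ℝ} (hM0 : 0 ≤ M)
    (n : ℕ) (hn : 1 ≤ n) {b : ℝ} (hb : 0 < b) (hbT : b < T) :
    ∃ M' : ℝ, 0 ≤ M' ∧ ∀ ⦃u : ℝ → EuclideanSpace ℝ (Fin 3) → EuclideanSpace ℝ (Fin 3)⦄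
      ⦃p : ℝ → EuclideanSpace ℝ (Fin 3) → ℝ⦄,
      IsClassicalNSSolutionOn (Icc 0 T) ν 0 u p →
      ((∀ m ≤ 1, ∀ t ∈ Icc 0 T, Integrable (levelSq m (u t)) ∧ ∫ x, levelSq m (u t) x ≤ M) ∧
        ∀ R : ℝ, 1 ≤ R → ∫ τ in Ioo 0 T, ∫ x, cutoff R x ^ 2 * levelSq 2 (u τ) x ≤ M) →
      ((∀ m ≤ n, ∀ t ∈ Icc b T, Integrable (levelSq m (u t)) ∧ ∫ x, levelSq m (u t) x ≤ M') ∧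
        ∀ R : ℝ, 1 ≤ R →
          ∫ τ in Ioo b T, ∫ x, cutoff R x ^ 2 * levelSq (n + 1) (u τ) x ≤ M') := by
  induction n, hn using Nat.le_induction generalizing b with
  | base =>
      refine ⟨M, hM0, fun u p h hL => ⟨fun m hm t ht => hL.1 m hm t ⟨hb.le.trans ht.1, ht.2⟩,
        fun R hR => (h.integral_Ioo_cutoff_levelSq_mono_left hT 2 le_rfl hb.le hR).trans
          (hL.2 R hR)⟩⟩
  | succ n hn ih =>
      obtain ⟨M', hM'0, hM'⟩ := ih (b := b / 2) (by linarith) (by linarith)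
      obtain ⟨M'', hM''0, hM''⟩ := sobolevLevels_succ_quant hν hT hn
        (by linarith : (0 : ℝ) ≤ b / 2) (by linarith : b / 2 < b) hbT hM'0
      exact ⟨M'', hM''0, fun u p h hL => hM'' h (hM' h hL)⟩

/-! ## Discharge of `tao2011_quantitative_regularity` -/

/-- **Tao 2011, Lemma 5.5 (Quantitative regularity) holds** in the form vendored as
`tao2011_quantitative_regularity` (arXiv:1108.1165, Lemma 32, pp. 18–19 = Anal. PDE 6 (2013),
Lemma 5.5: "`‖u‖_{L^∞_t H^k_x([τ,T] × ℝ³)} ≲_{k,τ,T,M} 1` for all natural numbers `k ≥ 1` and all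
`0 < τ < T`", homogeneous case, viscosity `ν > 0`, classical solutions in the smooth `H¹` class,
hypothesis the `X¹` bound with which the printed proof starts): for every `k`, `ν > 0`,
`0 < τ < T` and `E, S, I` there is `C = C(k, ν, τ, T, E, S, I)` with `∫ ‖Dᵏu(t)‖² ≤ C` on `[τ, T]`
for every classical solution of the unforced system on `[0, T] × ℝ³` with `∫|u(t)|² ≤ E`,
`∫|∇u(t)|² ≤ S` on `[0, T]` and `∫₀ᵀ∫‖D²u‖² ≤ I`. The proof is the physical-space energy method of
the tree made quantitative (`sobolevLevels_quant`), not Tao's Duhamel argument; the smooth-class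
hypotheses of the fact (`u, ∂ₜu, p ∈ L^∞_t H^k_x`) are not used. [cite: Tao2011, Lemma 5.5] -/
theorem tao2011_quantitative_regularity_holds : tao2011_quantitative_regularity := by
  intro k ν τ T hν hτ hτT E S I
  have hT : 0 < T := hτ.trans hτT
  -- one level-one bound for the three hypotheses
  set M : ℝ := (E : ℝ) + (S : ℝ) + 27 * (I : ℝ) with hM
  have hM0 : 0 ≤ M := by positivity
  have hEM : (E : ℝ) ≤ M := by rw [hM]; nlinarith [S.coe_nonneg, I.coe_nonneg]
  have hSM : (S : ℝ) ≤ M := by rw [hM]; nlinarith [E.coe_nonneg, I.coe_nonneg]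
  have hIM : 27 * (I : ℝ) ≤ M := by rw [hM]; nlinarith [E.coe_nonneg, S.coe_nonneg]
  obtain ⟨M', hM'0, hM'⟩ := sobolevLevels_quant hν hT hM0 (max k 1) (le_max_right _ _) hτ hτT
  refine ⟨(3 ^ (k + 1) * M').toNNReal, fun u p h _ _ _ hE hS hI t ht => ?_⟩
  have hTT : T ∈ Icc 0 T := ⟨hT.le, le_rfl⟩
  -- the level-one hypotheses in coordinate-tensor form
  have hlev : ∀ m ≤ 1, ∀ s ∈ Icc 0 T,
      Integrable (levelSq m (u s)) ∧ ∫ x, levelSq m (u s) x ≤ M := by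
    intro m hm s hs
    have hv := h.contDiff_velocity hs
    rcases Nat.le_one_iff_eq_zero_or_eq_one.1 hm with rfl | rfl
    · -- level `0`: `|∇⁰u|² = |u|²`
      have hle : ∫⁻ x, ENNReal.ofReal (levelSq 0 (u s) x) ≤ ENNReal.ofReal M := by
        calc ∫⁻ x, ENNReal.ofReal (levelSq 0 (u s) x) = ∫⁻ x, ‖u s x‖ₑ ^ 2 :=
              lintegral_congr fun x => by
                rw [levelSq_zero_eq_norm_sq, ENNReal.ofReal_pow (norm_nonneg _), ofReal_norm]
          _ ≤ E := hE s hs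
          _ ≤ ENNReal.ofReal M := by
              rw [← ENNReal.ofReal_coe_nnreal]; exact ENNReal.ofReal_le_ofReal hEM
      exact integrable_and_integral_le_of_lintegral_ofReal_le (continuous_levelSq hv 0)
        (levelSq_nonneg 0 _) hM0 hle
    · -- level `1`: `|∇u|² = |Du|²_F`
      have hle : ∫⁻ x, ENNReal.ofReal (levelSq 1 (u s) x) ≤ ENNReal.ofReal M := by
        calc ∫⁻ x, ENNReal.ofReal (levelSq 1 (u s) x)
              = ∫⁻ x, ENNReal.ofReal (frobeniusNormSq (fderiv ℝ (u s) x)) :=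
              lintegral_congr fun x => by
                rw [levelSq_one_eq_frobeniusNormSq
                  ((hv.differentiable (by simp)).differentiableAt)]
          _ ≤ S := hS s hs
          _ ≤ ENNReal.ofReal M := by
              rw [← ENNReal.ofReal_coe_nnreal]; exact ENNReal.ofReal_le_ofReal hSM
      exact integrable_and_integral_le_of_lintegral_ofReal_le (continuous_levelSq hv 1)
        (levelSq_nonneg 1 _) hM0 hle
  -- the dissipation: `∫₀ᵀ ∫ χ_R² |∇²u|² ≤ 27 ∫₀ᵀ ∫⁻ ‖D²u‖ₑ² ≤ 27 I`
  have hdis : ∀ R : ℝ, 1 ≤ R → ∫ s in Ioo 0 T, ∫ x, cutoff R x ^ 2 * levelSq 2 (u s) x ≤ M := by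
    intro R hR
    have hR0 : 0 < R := by linarith
    have cY := h.continuousOn_integral_cutoff_pow_mul_levelSq hT hR0 2 2 two_ne_zero
    have iY := integrableOn_Ioo_of_continuousOn cY hTT
    have hY0 : ∀ s, 0 ≤ ∫ x, cutoff R x ^ 2 * levelSq 2 (u s) x := fun s =>
      integral_nonneg fun x => mul_nonneg (sq_nonneg _) (levelSq_nonneg _ _ _)
    have h27 : ENNReal.ofReal (∫ s in Ioo 0 T, ∫ x, cutoff R x ^ 2 * levelSq 2 (u s) x) ≤
        ENNReal.ofReal (3 ^ (2 + 1)) * I := by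
      rw [ofReal_integral_eq_lintegral_ofReal iY (ae_of_all _ hY0)]
      calc ∫⁻ s in Ioo 0 T, ENNReal.ofReal (∫ x, cutoff R x ^ 2 * levelSq 2 (u s) x)
          ≤ ∫⁻ s in Ioo 0 T, ENNReal.ofReal (3 ^ (2 + 1)) *
              ∫⁻ x, ‖iteratedFDeriv ℝ 2 (u s) x‖ₑ ^ 2 :=
            setLIntegral_mono' measurableSet_Ioo fun s hs' =>
              ofReal_integral_cutoff_sq_mul_levelSq_le
                (h.contDiff_velocity ⟨hs'.1.le, hs'.2.le⟩) hR0 2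
        _ = ENNReal.ofReal (3 ^ (2 + 1)) *
              ∫⁻ s in Ioo 0 T, ∫⁻ x, ‖iteratedFDeriv ℝ 2 (u s) x‖ₑ ^ 2 :=
            lintegral_const_mul' _ _ ENNReal.ofReal_ne_top
        _ ≤ ENNReal.ofReal (3 ^ (2 + 1)) * I := by gcongr
    have h27' : ∫ s in Ioo 0 T, ∫ x, cutoff R x ^ 2 * levelSq 2 (u s) x ≤ 27 * I := by
      rw [← ENNReal.ofReal_le_ofReal_iff (by positivity)]
      refine h27.trans (le_of_eq ?_)
      rw [ENNReal.ofReal_mul (by norm_num), ENNReal.ofReal_coe_nnreal]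
      norm_num
    exact h27'.trans hIM
  -- the levels at order `max k 1` from time `τ` on, and back to `‖Dᵏu‖²`
  obtain ⟨hi, hle⟩ := (hM' h ⟨hlev, hdis⟩).1 k (le_max_left _ _) t ht
  have hv := h.contDiff_velocity ⟨hτ.le.trans ht.1, ht.2⟩
  refine (lintegral_sq_norm_iteratedFDeriv_le hv k hi).trans ?_
  rw [← ENNReal.ofReal_coe_nnreal, Real.coe_toNNReal']
  exact ENNReal.ofReal_le_ofReal (le_trans (mul_le_mul_of_nonneg_left hle (by positivity))
    (le_max_left _ _))

end Literature.Analysis.FluidPDE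

end
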